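import Summits.CriticalPhenomena.PercolationContinuityZ3.Theorems.PercNearOneGluingNoHeavyLowerTailKNGoodGMgcCellTools
import Summits.CriticalPhenomena.PercolationContinuityZ3.Theorems.PercNearOneGluingNoHeavyLowerTailKNGoodSeriesGlue
import HarnessLib

/-!
# Corner (1,1,1): the observer glued to three children = the observer `x` of `(G − o)[xz ↦ 1][xy ↦ 1]`
# (`NoHeavyLowerTail` cell, stmt-CriticalPhenomena-4575; prover `prim-hp-2`, gen 19 — forced ↔ contracted translation for KEY3, MEMO-gen19 §7)
Support file (`--supports stmt-CriticalPhenomena-4575`; imports the COMPUTATIONAL `…SideGlue` via `…CellTools`).  Small definitions (`emb4`,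
`starSet`, `pathSet`), no named facts, no sorries.  With `w⁰ = pinW w {pairs at o} ∅`, `W₃ = w⁰[ox,oy,oz ↦ 1]` (forced graph of the star
`{x,y,z}`, `UpsetExchange.real_inter_starEvent_eq_mul_forced`) and `U = w⁰[xz ↦ 1][xy ↦ 1]` (`…BlobTarget`): **`agood_wzero_glue_three`**:
`agood(W₃, o; a) = agood(U, x; a)` — reliabilities by `real_openConn_glue_congr` (V = {o}; certificates `cert_three`), clusters by push-forward
+ `reachable_union_transfer`, pockets by peeling sure pairs (`real_update_eq_of_preimage_insert_eq`) and `real_openConnIn_erase_wzero`,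
reindexed by `KNGoodSeries.sum_nullSets_reindex_erase` (pattern of `agood_wzero_glue_two`).
-/

noncomputable section

namespace Summit.CriticalPhenomena.PercolationContinuityZ3.Theorems

namespace KNGoodGMgc

open MeasureTheory Set Literature.Probability.LatticeModels Literature.Probability.Percolation KNGoodAux KNGoodHair KNGoodSeries
  RelayNbhd
open scoped Classical BigOperators

variable {n : ℕ}

/-- The forced graph of the star `{x,y,z}` is `(G − o)[ox ↦ 1][oy ↦ 1][oz ↦ 1]`. [this work] -/
theorem forced_eq_update_three (w : Sym2 (Fin n) → unitInterval) (o x y z : Fin n) (hloop : w s(o, o) = 0) :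
    (fun e : Sym2 (Fin n) => if o ∈ e then (if ∃ p ∈ ({x, y, z} : Finset (Fin n)), e = s(o, p) then 1 else 0) else w e) =
      Function.update (Function.update (Function.update (pinW w {e : Sym2 (Fin n) | o ∈ e ∧ ¬ e.IsDiag} ∅) s(o, x) 1) s(o, y) 1)
        s(o, z) 1 := by
  funext e
  by_cases hez : e = s(o, z)
  · subst hez; simp
  rw [Function.update_of_ne hez]
  by_cases hey : e = s(o, y)
  · subst hey; simp
  rw [Function.update_of_ne hey]
  by_cases hex : e = s(o, x)
  · subst hex; simp
  rw [Function.update_of_ne hex]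
  by_cases hoe : o ∈ e
  · have hno : ¬∃ p ∈ ({x, y, z} : Finset (Fin n)), e = s(o, p) := by
      rintro ⟨p, hp, rfl⟩
      simp only [Finset.mem_insert, Finset.mem_singleton] at hp
      rcases hp with rfl | rfl | rfl
      · exact hex rfl
      · exact hey rfl
      · exact hez rfl
    simp only [hoe, if_true, hno, if_false]
    by_cases hd : e.IsDiag
    · have : e = s(o, o) := by
        induction e using Sym2.ind with
        | h p q =>
          have hpq : p = q := Sym2.mk_isDiag_iff.1 hd
          subst hpq
          rcases Sym2.mem_iff.1 hoe with rfl | rfl <;> rfl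
      rw [this, pinW_apply_of_not_mem w ∅ (fun h => h.2 (by simp)), hloop]
    · exact (pinW_apply_of_mem_of_not_mem w (F := {e : Sym2 (Fin n) | o ∈ e ∧ ¬ e.IsDiag}) ⟨hoe, hd⟩ (Set.notMem_empty _)).symm
  · simp only [hoe, if_false]
    exact (pinW_apply_of_not_mem w ∅ (fun h => hoe h.1)).symm

/-- A reachable isolated vertex is the start. [folklore] -/
theorem eq_of_reachable_isolated {ω : BondConfig (Fin n)} {o v : Fin n} (hiso : ∀ e ∈ ω, o ∉ e)
    (h : (openGraph ω).Reachable v o) : v = o := by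
  obtain ⟨p⟩ := h
  cases hp : p.reverse with
  | nil => rfl
  | cons hadj _ =>
    obtain ⟨hmem, -⟩ := (openGraph_adj ω _ _).1 hadj
    exact absurd (Sym2.mem_mk_left _ _) (hiso _ hmem)

/-- A cluster contains its root: `μ(C(v) = W) = 0` if `v ∉ W`. [folklore] -/
theorem real_clusterIs_eq_zero_of_not_mem (u : Sym2 (Fin n) → unitInterval) (v : Fin n) (W : Finset (Fin n)) (h : v ∉ W) :
    (prodBernoulli u).real (clusterIs v W) = 0 := by
  have : (clusterIs v W : Set (BondConfig (Fin n))) = ∅ := by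
    ext ω
    simp only [mem_empty_iff_false, iff_false]
    intro hω
    rw [mem_clusterIs] at hω
    have : v ∈ openCluster ω v := mem_openCluster_self ω v
    rw [hω, Finset.mem_coe] at this
    exact h this
  rw [this, measureReal_empty]

/-- Placement of the abstract vertices `0,1,2,3 ↦ o,x,y,z`. [this work] -/
def emb4 (o x y z : Fin n) (i : ℕ) : Fin n := if i = 0 then o else if i = 1 then x else if i = 2 then y else z

/-- The glue set of the forced graph: the star `o–x, o–y, o–z`. [this work] -/
def starSet (o x y z : Fin n) : Finset (Sym2 (Fin n)) := cimg (emb4 o x y z) [(0, 1), (0, 2), (0, 3)]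

/-- The glue set of the contracted graph: the path `x–z, x–y`. [this work] -/
def pathSet (o x y z : Fin n) : Finset (Sym2 (Fin n)) := cimg (emb4 o x y z) [(1, 3), (1, 2)]

/-- `starSet = {ox, oy, oz}`. [this work] -/
theorem starSet_eq (o x y z : Fin n) : starSet o x y z = {s(o, x), s(o, y), s(o, z)} := by simp [starSet, cimg, emb4]

/-- `pathSet = {xz, xy}`. [this work] -/
theorem pathSet_eq (o x y z : Fin n) : pathSet o x y z = {s(x, z), s(x, y)} := by simp [pathSet, cimg, emb4]

/-- Certificates for the star `{o–x, o–y, o–z}` and the path `{x–z, x–y}` on the abstract vertices `0..3`. [this work] -/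
theorem cert_three :
    edgesOK 4 [(0, 1), (0, 2), (0, 3)] = true ∧ edgesOK 4 [(1, 3), (1, 2)] = true ∧
    parOK 4 [(0, 1), (0, 2), (0, 3)] (parOf [0, 0, 0, 0]) = true ∧ parOK 4 [(1, 3), (1, 2)] (parOf [0, 1, 1, 1]) = true ∧
    labOK 4 [(0, 1), (0, 2), (0, 3)] (parOf [0, 0, 0, 0]) = true ∧ labOK 4 [(1, 3), (1, 2)] (parOf [0, 1, 1, 1]) = true ∧
    (∀ i ∈ [1, 2, 3], ∀ j ∈ [1, 2, 3],
      (root 4 (parOf [0, 0, 0, 0]) i == root 4 (parOf [0, 0, 0, 0]) j) = (root 4 (parOf [0, 1, 1, 1]) i == root 4 (parOf [0, 1, 1, 1]) j)) := by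
  refine ⟨by decide, by decide, by decide, by decide, by decide, by decide, by decide⟩

/-- The two glue sets connect the vertices off `o` identically. [this work] -/
theorem reachable_star_iff_path (o x y z : Fin n) (hxo : x ≠ o) (hyo : y ≠ o) (hzo : z ≠ o) (hxy : x ≠ y) (hxz : x ≠ z) (hyz : y ≠ z)
    (c₁ c₂ : Fin n) (h₁ : c₁ ∉ ({o} : Finset (Fin n))) (h₂ : c₂ ∉ ({o} : Finset (Fin n))) :
    (openGraph (↑(starSet o x y z) : BondConfig (Fin n))).Reachable c₁ c₂ ↔
      (openGraph (↑(pathSet o x y z) : BondConfig (Fin n))).Reachable c₁ c₂ := by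
  unfold starSet pathSet
  have hφinj : ∀ i j : ℕ, i < 4 → j < 4 → emb4 o x y z i = emb4 o x y z j → i = j := by
    intro i j hi hj h
    interval_cases i <;> interval_cases j <;> simp_all [emb4, eq_comm]
  rw [Finset.mem_singleton] at h₁ h₂
  have hne : ∀ {c : Fin n}, c ≠ o → ∀ i : ℕ, i < 4 → i ∉ [1, 2, 3] → c ≠ emb4 o x y z i := by
    intro c hc i hi hiP
    interval_cases i
    · simpa [emb4] using hc
    all_goals simp at hiP
  obtain ⟨c1, c2, c3, c4, c5, c6, c7⟩ := cert_three
  exact reachable_iff_of_cert (emb4 o x y z) 4 hφinj [1, 2, 3] [(0, 1), (0, 2), (0, 3)] [(1, 3), (1, 2)] (parOf [0, 0, 0, 0])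
    (parOf [0, 1, 1, 1]) c1 c2 c3 c4 c5 c6 c7 (hne h₁) (hne h₂)

/-- `G − o` vanishes at `o` (loop included). [this work] -/
theorem wzero_vanish (w : Sym2 (Fin n) → unitInterval) (o : Fin n) (hloop : w s(o, o) = 0) : ∀ e : Sym2 (Fin n), (∃ v ∈ ({o} : Finset (Fin n)), v ∈ e) →
    pinW w {e : Sym2 (Fin n) | o ∈ e ∧ ¬ e.IsDiag} ∅ e = 0 := by
  rintro e ⟨v, hv, hve⟩
  rw [Finset.mem_singleton] at hv; subst hv
  by_cases hd : e.IsDiag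
  · have : e = s(v, v) := by
      induction e using Sym2.ind with
      | h p q =>
        have hpq : p = q := Sym2.mk_isDiag_iff.1 hd
        subst hpq; rcases Sym2.mem_iff.1 hve with rfl | rfl <;> rfl
    rw [this, pinW_apply_of_not_mem w ∅ (fun h => h.2 (by simp)), hloop]
  · exact pinW_apply_of_mem_of_not_mem w (F := {e : Sym2 (Fin n) | v ∈ e ∧ ¬ e.IsDiag}) ⟨hve, hd⟩ (Set.notMem_empty _)

/-- The forced graph in glue-set form. [this work] -/
theorem forcedThree_eq_glue (w : Sym2 (Fin n) → unitInterval) (o x y z : Fin n) :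
    Function.update (Function.update (Function.update (pinW w {e : Sym2 (Fin n) | o ∈ e ∧ ¬ e.IsDiag} ∅) s(o, x) 1) s(o, y) 1) s(o, z) 1 =
      fun f => if f ∈ starSet o x y z then 1 else pinW w {e : Sym2 (Fin n) | o ∈ e ∧ ¬ e.IsDiag} ∅ f := by
  funext f; rw [starSet_eq]
  simp only [Finset.mem_insert, Finset.mem_singleton]
  by_cases h1 : f = s(o, z)
  · subst h1; simp
  rw [Function.update_of_ne h1]
  by_cases h2 : f = s(o, y)
  · subst h2; simp
  rw [Function.update_of_ne h2]
  by_cases h3 : f = s(o, x)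
  · subst h3; simp
  rw [Function.update_of_ne h3]; simp [h1, h2, h3]

/-- The contracted graph in glue-set form. [this work] -/
theorem contractedThree_eq_glue (w : Sym2 (Fin n) → unitInterval) (o x y z : Fin n) :
    Function.update (Function.update (pinW w {e : Sym2 (Fin n) | o ∈ e ∧ ¬ e.IsDiag} ∅) s(x, z) 1) s(x, y) 1 =
      fun f => if f ∈ pathSet o x y z then 1 else pinW w {e : Sym2 (Fin n) | o ∈ e ∧ ¬ e.IsDiag} ∅ f := by
  funext f; rw [pathSet_eq]
  simp only [Finset.mem_insert, Finset.mem_singleton]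
  by_cases h1 : f = s(x, y)
  · subst h1; simp
  rw [Function.update_of_ne h1]
  by_cases h2 : f = s(x, z)
  · subst h2; simp
  rw [Function.update_of_ne h2]; simp [h1, h2]

/-- Reliabilities off `o` agree in the forced and the contracted graph. [this work] -/
theorem glue_three_openConn (w : Sym2 (Fin n) → unitInterval) (o x y z : Fin n) (hxo : x ≠ o) (hyo : y ≠ o) (hzo : z ≠ o) (hxy : x ≠ y) (hxz : x ≠ z)
    (hyz : y ≠ z) (hloop : w s(o, o) = 0) (p q : Fin n) (hp : p ≠ o) (hq : q ≠ o) :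
    (prodBernoulli (Function.update (Function.update (Function.update (pinW w {e : Sym2 (Fin n) | o ∈ e ∧ ¬ e.IsDiag} ∅)
        s(o, x) 1) s(o, y) 1) s(o, z) 1)).real (openConn p q) =
      (prodBernoulli (Function.update (Function.update (pinW w {e : Sym2 (Fin n) | o ∈ e ∧ ¬ e.IsDiag} ∅) s(x, z) 1) s(x, y) 1)).real
        (openConn p q) := by
  rw [forcedThree_eq_glue w o x y z, contractedThree_eq_glue w o x y z]
  exact real_openConn_glue_congr _ {o} (wzero_vanish w o hloop) _ _
    (reachable_star_iff_path o x y z hxo hyo hzo hxy hxz hyz) p q (by rwa [Finset.mem_singleton]) (by rwa [Finset.mem_singleton])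

/-- Cluster terms: `μ_{W₃}(C(o) = W) = μ_U(C(x) = W ∖ {o})` for `o ∈ W`. [this work] -/
theorem glue_three_clusterIs (w : Sym2 (Fin n) → unitInterval) (o x y z : Fin n) (hxo : x ≠ o) (hyo : y ≠ o) (hzo : z ≠ o) (hxy : x ≠ y) (hxz : x ≠ z)
    (hyz : y ≠ z) (hloop : w s(o, o) = 0) (W : Finset (Fin n)) (hoW : o ∈ W) :
    (prodBernoulli (Function.update (Function.update (Function.update (pinW w {e : Sym2 (Fin n) | o ∈ e ∧ ¬ e.IsDiag} ∅)
        s(o, x) 1) s(o, y) 1) s(o, z) 1)).real (clusterIs o W) =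
      (prodBernoulli (Function.update (Function.update (pinW w {e : Sym2 (Fin n) | o ∈ e ∧ ¬ e.IsDiag} ∅) s(x, z) 1) s(x, y) 1)).real
        (clusterIs x (W.erase o)) := by
  haveI : ∀ u : Sym2 (Fin n) → unitInterval, IsProbabilityMeasure (prodBernoulli u) := fun u => inferInstance
  have hox : o ≠ x := fun h => hxo h.symm
  set w0 := pinW w {e : Sym2 (Fin n) | o ∈ e ∧ ¬ e.IsDiag} ∅ with hw0
  set D : Finset (Sym2 (Fin n)) := starSet o x y z with hD
  set D' : Finset (Sym2 (Fin n)) := pathSet o x y z with hD'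
  have hDeq : D = {s(o, x), s(o, y), s(o, z)} := starSet_eq o x y z
  have hD'eq : D' = {s(x, z), s(x, y)} := pathSet_eq o x y z
  have hK := wzero_vanish w o hloop
  have hDD' := reachable_star_iff_path o x y z hxo hyo hzo hxy hxz hyz
  rw [forcedThree_eq_glue w o x y z, contractedThree_eq_glue w o x y z,
    glueSet_pushforward w0 _ (↑D : Set (Sym2 (Fin n))) (fun f hf => by rw [if_pos (Finset.mem_coe.1 hf)])
      (fun f hf => by rw [if_neg (fun h => hf (Finset.mem_coe.2 h))]) (clusterIs o W),
    glueSet_pushforward w0 _ (↑D' : Set (Sym2 (Fin n))) (fun f hf => by rw [if_pos (Finset.mem_coe.1 hf)])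
      (fun f hf => by rw [if_neg (fun h => hf (Finset.mem_coe.2 h))]) (clusterIs x (W.erase o))]
  set N : Set (BondConfig (Fin n)) := {ω | ∃ e ∈ ω, ∃ v ∈ ({o} : Finset (Fin n)), v ∈ e} with hN
  have hN0 : (prodBernoulli w0).real N = 0 := real_exists_openAt_eq_zero w0 {o} hK
  have transfer : ∀ ω : BondConfig (Fin n), ω ∉ N → ∀ p q : Fin n, p ≠ o → q ≠ o →
      ((openGraph (ω ∪ ↑D : BondConfig (Fin n))).Reachable p q ↔ (openGraph (ω ∪ ↑D' : BondConfig (Fin n))).Reachable p q) := by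
    intro ω hω p q hp hq
    have hωo : ∀ e ∈ ω, ∀ v ∈ e, v ∉ (↑({o} : Finset (Fin n)) : Set (Fin n)) :=
      fun e he v hv hvo => hω ⟨e, he, v, Finset.mem_coe.1 hvo, hv⟩
    have hp' : p ∉ (↑({o} : Finset (Fin n)) : Set (Fin n)) := fun h => hp (Finset.mem_singleton.1 (Finset.mem_coe.1 h))
    have hq' : q ∉ (↑({o} : Finset (Fin n)) : Set (Fin n)) := fun h => hq (Finset.mem_singleton.1 (Finset.mem_coe.1 h))
    constructor
    · exact reachable_union_transfer ω _ ↑D ↑D' hωo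
        (fun c₁ c₂ hc₁ hc₂ => (hDD' c₁ c₂ (fun h => hc₁ (Finset.mem_coe.2 h)) (fun h => hc₂ (Finset.mem_coe.2 h))).1) hp' hq'
    · exact reachable_union_transfer ω _ ↑D' ↑D hωo
        (fun c₁ c₂ hc₁ hc₂ => (hDD' c₁ c₂ (fun h => hc₁ (Finset.mem_coe.2 h)) (fun h => hc₂ (Finset.mem_coe.2 h))).2) hp' hq'
  have hoxD : ∀ ω : BondConfig (Fin n), (openGraph (ω ∪ ↑D : BondConfig (Fin n))).Reachable o x := by
    intro ω
    refine SimpleGraph.Adj.reachable ((openGraph_adj _ o x).2 ⟨Or.inr (Finset.mem_coe.2 ?_), hox⟩)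
    rw [hDeq]; simp
  have hisoU : ∀ ω : BondConfig (Fin n), ω ∉ N → ∀ e ∈ (ω ∪ ↑D' : BondConfig (Fin n)), o ∉ e := by
    intro ω hω e he hoe
    rcases he with he | he
    · exact hω ⟨e, he, o, Finset.mem_singleton_self o, hoe⟩
    · have he' : e ∈ D' := Finset.mem_coe.1 he
      rw [hD'eq] at he'
      simp only [Finset.mem_insert, Finset.mem_singleton] at he'
      rcases he' with rfl | rfl
      · rcases Sym2.mem_iff.1 hoe with h | h; exact hxo h.symm; exact hzo h.symm
      · rcases Sym2.mem_iff.1 hoe with h | h; exact hxo h.symm; exact hyo h.symm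
  refine real_eq_of_inter_compl_eq (prodBernoulli w0) _ _ N hN0 ?_
  ext ω
  simp only [mem_inter_iff, mem_compl_iff, mem_setOf_eq]
  refine and_congr_left fun hω => ?_
  rw [mem_clusterIs, mem_clusterIs]
  constructor
  · intro h
    ext v
    rw [Finset.coe_erase, mem_sdiff, mem_singleton_iff]
    constructor
    · intro hv
      have hvo : v ≠ o := fun hvo => by
        subst hvo; exact hxo (eq_of_reachable_isolated (hisoU ω hω) hv)
      refine ⟨?_, hvo⟩
      rw [← h]
      exact (hoxD ω).trans ((transfer ω hω x v hxo hvo).2 hv)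
    · rintro ⟨hvW, hvo⟩
      have : v ∈ openCluster (ω ∪ ↑D : BondConfig (Fin n)) o := by rw [h]; exact hvW
      exact (transfer ω hω x v hxo hvo).1 ((hoxD ω).symm.trans this)
  · intro h
    ext v
    by_cases hvo : v = o
    · subst hvo
      simp only [Finset.mem_coe, hoW, iff_true]
      exact mem_openCluster_self _ _
    · constructor
      · intro hv
        have hxv : (openGraph (ω ∪ ↑D' : BondConfig (Fin n))).Reachable x v :=
          (transfer ω hω x v hxo hvo).1 ((hoxD ω).symm.trans hv)
        have : v ∈ openCluster (ω ∪ ↑D' : BondConfig (Fin n)) x := hxv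
        rw [h, Finset.coe_erase, mem_sdiff] at this
        exact this.1
      · intro hvW
        have : v ∈ openCluster (ω ∪ ↑D' : BondConfig (Fin n)) x := by
          rw [h, Finset.coe_erase, mem_sdiff, mem_singleton_iff]; exact ⟨hvW, hvo⟩
        exact (hoxD ω).trans ((transfer ω hω x v hxo hvo).2 this)

/-- In the contracted graph `o` is isolated: pockets containing `o` are impossible for `x`. [this work] -/
theorem contracted_clusterIs_zero (w : Sym2 (Fin n) → unitInterval) (o x y z : Fin n) (hxo : x ≠ o) (hyo : y ≠ o) (hzo : z ≠ o)
    (hloop : w s(o, o) = 0) (W : Finset (Fin n)) (hoW : o ∈ W) :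
    (prodBernoulli (Function.update (Function.update (pinW w {e : Sym2 (Fin n) | o ∈ e ∧ ¬ e.IsDiag} ∅) s(x, z) 1) s(x, y) 1)).real
      (clusterIs x W) = 0 := by
  haveI : ∀ u : Sym2 (Fin n) → unitInterval, IsProbabilityMeasure (prodBernoulli u) := fun u => inferInstance
  set w0 := pinW w {e : Sym2 (Fin n) | o ∈ e ∧ ¬ e.IsDiag} ∅ with hw0
  set D' : Finset (Sym2 (Fin n)) := pathSet o x y z with hD'
  have hD'eq : D' = {s(x, z), s(x, y)} := pathSet_eq o x y z
  have hK := wzero_vanish w o hloop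
  rw [contractedThree_eq_glue w o x y z,
    glueSet_pushforward w0 _ (↑D' : Set (Sym2 (Fin n))) (fun f hf => by rw [if_pos (Finset.mem_coe.1 hf)])
      (fun f hf => by rw [if_neg (fun h => hf (Finset.mem_coe.2 h))]) (clusterIs x W)]
  set N : Set (BondConfig (Fin n)) := {ω | ∃ e ∈ ω, ∃ v ∈ ({o} : Finset (Fin n)), v ∈ e} with hN
  have hN0 : (prodBernoulli w0).real N = 0 := real_exists_openAt_eq_zero w0 {o} hK
  rw [← measureReal_empty (μ := prodBernoulli w0)]
  refine real_eq_of_inter_compl_eq (prodBernoulli w0) _ _ N hN0 ?_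
  ext ω
  simp only [mem_inter_iff, mem_compl_iff, mem_setOf_eq, mem_empty_iff_false, false_and, iff_false, not_and]
  intro hω hωN
  have hisoU : ∀ e ∈ (ω ∪ ↑D' : BondConfig (Fin n)), o ∉ e := by
    intro e he hoe
    rcases he with he | he
    · exact hωN ⟨e, he, o, Finset.mem_singleton_self o, hoe⟩
    · have he' : e ∈ D' := Finset.mem_coe.1 he
      rw [hD'eq] at he'
      simp only [Finset.mem_insert, Finset.mem_singleton] at he'
      rcases he' with rfl | rfl
      · rcases Sym2.mem_iff.1 hoe with h | h; exact hxo h.symm; exact hzo h.symm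
      · rcases Sym2.mem_iff.1 hoe with h | h; exact hxo h.symm; exact hyo h.symm
  rw [mem_clusterIs] at hω
  have : o ∈ openCluster (ω ∪ ↑D' : BondConfig (Fin n)) x := by rw [hω]; exact Finset.mem_coe.2 hoW
  exact hxo (eq_of_reachable_isolated hisoU this)

/-- Pocket minima in the forced graph: the sure pairs at `o ∈ W` are invisible off `W`. [this work] -/
theorem forced_openConnIn (w : Sym2 (Fin n) → unitInterval) (o x y z : Fin n) (hxo : x ≠ o) (hyo : y ≠ o) (hzo : z ≠ o) (hxy : x ≠ y)
    (hxz : x ≠ z) (hyz : y ≠ z) (W : Finset (Fin n)) (a' b : Fin n) (hoW : o ∈ W) :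
    (prodBernoulli (Function.update (Function.update (Function.update (pinW w {e : Sym2 (Fin n) | o ∈ e ∧ ¬ e.IsDiag} ∅)
        s(o, x) 1) s(o, y) 1) s(o, z) 1)).real (openConnIn ((↑W : Set (Fin n))ᶜ) a' b) =
      (prodBernoulli (pinW w {e : Sym2 (Fin n) | o ∈ e ∧ ¬ e.IsDiag} ∅)).real (openConnIn ((↑W : Set (Fin n))ᶜ) a' b) := by
  set w0 := pinW w {e : Sym2 (Fin n) | o ∈ e ∧ ¬ e.IsDiag} ∅ with hw0
  have hw0o : ∀ v : Fin n, v ≠ o → w0 s(o, v) = 0 := fun v hv => pinW_star_mk w hv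
  have e3 : Function.update (Function.update (Function.update w0 s(o, x) 1) s(o, y) 1) s(o, z) 0 =
      Function.update (Function.update w0 s(o, x) 1) s(o, y) 1 := by
    rw [Function.update_eq_self_iff, Function.update_of_ne (fun h => hyz (Sym2.congr_right.1 h).symm),
      Function.update_of_ne (fun h => hxz (Sym2.congr_right.1 h).symm)]; exact (hw0o z hzo).symm
  have e2 : Function.update (Function.update w0 s(o, x) 1) s(o, y) 0 = Function.update w0 s(o, x) 1 := by
    rw [Function.update_eq_self_iff, Function.update_of_ne (fun h => hxy (Sym2.congr_right.1 h).symm)]; exact (hw0o y hyo).symm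
  have e1 : Function.update w0 s(o, x) 0 = w0 := by rw [Function.update_eq_self_iff]; exact (hw0o x hxo).symm
  rw [real_update_eq_of_preimage_insert_eq _ s(o, z) _ (preimage_insert_openConnIn_eq W o z a' b hoW) 1, e3,
    real_update_eq_of_preimage_insert_eq _ s(o, y) _ (preimage_insert_openConnIn_eq W o y a' b hoW) 1, e2,
    real_update_eq_of_preimage_insert_eq _ s(o, x) _ (preimage_insert_openConnIn_eq W o x a' b hoW) 1, e1]

/-- Pocket minima in the contracted graph: the sure pairs at `x ∈ W` are invisible off `W`. [this work] -/
theorem contracted_openConnIn (w : Sym2 (Fin n) → unitInterval) (o x y z : Fin n) (hyz : y ≠ z) (W : Finset (Fin n)) (a' b : Fin n) (hxW : x ∈ W) :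
    (prodBernoulli (Function.update (Function.update (pinW w {e : Sym2 (Fin n) | o ∈ e ∧ ¬ e.IsDiag} ∅) s(x, z) 1) s(x, y) 1)).real
        (openConnIn ((↑W : Set (Fin n))ᶜ) a' b) =
      (prodBernoulli (pinW w {e : Sym2 (Fin n) | o ∈ e ∧ ¬ e.IsDiag} ∅)).real (openConnIn ((↑W : Set (Fin n))ᶜ) a' b) := by
  set w0 := pinW w {e : Sym2 (Fin n) | o ∈ e ∧ ¬ e.IsDiag} ∅ with hw0
  have hw0xy : (Function.update w0 s(x, z) 1) s(x, y) = w0 s(x, y) := Function.update_of_ne (fun h => hyz (Sym2.congr_right.1 h)) _ _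
  rw [real_update_eq_of_preimage_insert_eq _ s(x, y) _ (preimage_insert_openConnIn_eq W x y a' b hxW) 1,
    ← real_update_eq_of_preimage_insert_eq _ s(x, y) _ (preimage_insert_openConnIn_eq W x y a' b hxW) (w0 s(x, y)), ← hw0xy,
    Function.update_eq_self, real_update_eq_of_preimage_insert_eq w0 s(x, z) _ (preimage_insert_openConnIn_eq W x z a' b hxW) 1,
    ← real_update_eq_of_preimage_insert_eq w0 s(x, z) _ (preimage_insert_openConnIn_eq W x z a' b hxW) (w0 s(x, z)),
    Function.update_eq_self]


/-- **Corner (1,1,1).**  `o ∉ A`, `x,y,z ≠ o` distinct, `a ∈ A`, `b ≠ o`, loop at `o` of weight `0`: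
`agood(W₃, o; a) = agood(w⁰[xz ↦ 1][xy ↦ 1], x; a)` with `W₃` the forced graph of the star `{x,y,z}`. [this work] -/
theorem agood_wzero_glue_three (w : Sym2 (Fin n) → unitInterval) (A : Finset (Fin n)) (hA : A.Nonempty) (o x y z a b : Fin n)
    (ho : o ∉ A) (hxo : x ≠ o) (hyo : y ≠ o) (hzo : z ≠ o) (hxy : x ≠ y) (hxz : x ≠ z) (hyz : y ≠ z) (ha : a ∈ A) (hbo : b ≠ o)
    (hloop : w s(o, o) = 0) :
    (prodBernoulli (fun e : Sym2 (Fin n) => if o ∈ e then (if ∃ p ∈ ({x, y, z} : Finset (Fin n)), e = s(o, p) then 1 else 0) else w e)).real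
          (openConn o b) -
        (prodBernoulli (fun e : Sym2 (Fin n) => if o ∈ e then (if ∃ p ∈ ({x, y, z} : Finset (Fin n)), e = s(o, p) then 1 else 0)
          else w e)).real (openConn a b) +
        ∑ W ∈ nullSets A,
          (prodBernoulli (fun e : Sym2 (Fin n) => if o ∈ e then (if ∃ p ∈ ({x, y, z} : Finset (Fin n)), e = s(o, p) then 1 else 0)
            else w e)).real (clusterIs o W) *
          A.inf' hA (fun a' => (prodBernoulli (fun e : Sym2 (Fin n) => if o ∈ e then
            (if ∃ p ∈ ({x, y, z} : Finset (Fin n)), e = s(o, p) then 1 else 0) else w e)).real (openConnIn ((↑W : Set (Fin n))ᶜ) a' b)) =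
      (prodBernoulli (Function.update (Function.update (pinW w {e : Sym2 (Fin n) | o ∈ e ∧ ¬ e.IsDiag} ∅) s(x, z) 1) s(x, y) 1)).real
          (openConn x b) -
        (prodBernoulli (Function.update (Function.update (pinW w {e : Sym2 (Fin n) | o ∈ e ∧ ¬ e.IsDiag} ∅) s(x, z) 1) s(x, y) 1)).real
          (openConn a b) +
        ∑ W ∈ nullSets A,
          (prodBernoulli (Function.update (Function.update (pinW w {e : Sym2 (Fin n) | o ∈ e ∧ ¬ e.IsDiag} ∅) s(x, z) 1) s(x, y) 1)).real
            (clusterIs x W) *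
          A.inf' hA (fun a' => (prodBernoulli (Function.update (Function.update (pinW w {e : Sym2 (Fin n) | o ∈ e ∧ ¬ e.IsDiag} ∅)
            s(x, z) 1) s(x, y) 1)).real (openConnIn ((↑W : Set (Fin n))ᶜ) a' b)) := by
  haveI : ∀ u : Sym2 (Fin n) → unitInterval, IsProbabilityMeasure (prodBernoulli u) := fun u => inferInstance
  rw [forced_eq_update_three w o x y z hloop]
  have hox : o ≠ x := fun h => hxo h.symm
  have hao : a ≠ o := fun h => ho (h ▸ ha)
  have G := glue_three_openConn w o x y z hxo hyo hzo hxy hxz hyz hloop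
  -- (i) `μ(o b) = μ(x b)`: the sure pair `o–x`, then the glue congruence
  have hsure : Function.update (Function.update (Function.update (pinW w {e : Sym2 (Fin n) | o ∈ e ∧ ¬ e.IsDiag} ∅)
      s(o, x) 1) s(o, y) 1) s(o, z) 1 s(o, x) = 1 := by
    rw [Function.update_of_ne (fun h => hxz (Sym2.congr_right.1 h)), Function.update_of_ne (fun h => hxy (Sym2.congr_right.1 h)),
      Function.update_self]
  have h1 := (tripleTie_tau_eq_of_weight_one _ hox hsure b).trans (G x b hxo hbo)
  have h2 := G a b hao hbo
  -- (iii)+(iv) the pocket sums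
  have h3 := sum_nullSets_reindex_erase A o ho
    (fun W => (prodBernoulli (Function.update (Function.update (Function.update (pinW w {e : Sym2 (Fin n) | o ∈ e ∧ ¬ e.IsDiag} ∅)
      s(o, x) 1) s(o, y) 1) s(o, z) 1)).real (clusterIs o W) *
      A.inf' hA (fun a' => (prodBernoulli (Function.update (Function.update (Function.update
        (pinW w {e : Sym2 (Fin n) | o ∈ e ∧ ¬ e.IsDiag} ∅) s(o, x) 1) s(o, y) 1) s(o, z) 1)).real (openConnIn ((↑W : Set (Fin n))ᶜ) a' b)))
    (fun W => (prodBernoulli (Function.update (Function.update (pinW w {e : Sym2 (Fin n) | o ∈ e ∧ ¬ e.IsDiag} ∅) s(x, z) 1)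
      s(x, y) 1)).real (clusterIs x W) *
      A.inf' hA (fun a' => (prodBernoulli (Function.update (Function.update (pinW w {e : Sym2 (Fin n) | o ∈ e ∧ ¬ e.IsDiag} ∅)
        s(x, z) 1) s(x, y) 1)).real (openConnIn ((↑W : Set (Fin n))ᶜ) a' b)))
    (fun W _ hoW => by rw [real_clusterIs_eq_zero_of_not_mem _ o W hoW, zero_mul])
    (fun W _ hoW => by rw [contracted_clusterIs_zero w o x y z hxo hyo hzo hloop W hoW, zero_mul])
    (fun W _ hoW => by
      rw [glue_three_clusterIs w o x y z hxo hyo hzo hxy hxz hyz hloop W hoW]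
      by_cases hxW : x ∈ W.erase o
      · congr 1
        refine Finset.inf'_congr hA rfl fun a' ha' => ?_
        rw [forced_openConnIn w o x y z hxo hyo hzo hxy hxz hyz W a' b hoW,
          contracted_openConnIn w o x y z hyz (W.erase o) a' b hxW]
        exact real_openConnIn_erase_wzero w o a' b (fun h => ho (h ▸ ha')) W
      · rw [real_clusterIs_eq_zero_of_not_mem _ x _ hxW, zero_mul, zero_mul])
  rw [h1, h2, h3]

end KNGoodGMgc

end Summit.CriticalPhenomena.PercolationContinuityZ3.Theorems

end
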